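import Mathlib
import Summits.Ventures.Crystal3D.Theorems.StickyWulffConstantTextureLiminfTentCost
import HarnessLib

/-!
# The tent certificate for fcc grains — from cell costs to broken bonds near `U` (eng g8)

Route `StickyWulffConstant` (`Summits/Ventures/Crystal3D`, cell `crystal3d-full`), support toward the crux
`TextureLiminf` (stmt-Ventures-19483), FREE half (tent certificate, TexShadow v6.1).
* `card_coveredBonds_le_brokenNear` — every bond covered by a cell family whose closed chambers meet `U`
  has its occupied end within `√2` of `U`;
* `costR`, `sum_costR_le_tentCostOn24` — regrouping the per-cell costs of the cells meeting `U` (kind by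
  kind) under the local tent cost `tentCostOn24` of `…TentTablesLocal.lean`;
* `sum_costR_le_half_brokenNear` — hence `Σ cost/24 ≤ ½ · brokenNear X U`.
WHAT THIS IS NOT: the certificate (next file); F-C1 not moved.
-/

noncomputable section

namespace Summit.Ventures.Crystal3D.TentCertificate

open Finset Summit.Ventures.Crystal3D MeasureTheory
open Literature.Geometry.DiscreteGeometry (intVec intVec_apply)
open scoped RealInnerProductSpace

/-! ## Covered bonds are broken bonds near `U` -/

/-- **Covered bonds lie near `U`.** -/
theorem card_coveredBonds_le_brokenNear (X : Finset Site) (U : Set (EuclideanSpace ℝ (Fin 3)))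
    (Pup Pdn PO : Finset Site)
    (hup : ∀ p ∈ Pup, (closedChamber (labelUp p).1 (labelUp p).2 ∩ U).Nonempty)
    (hdn : ∀ p ∈ Pdn, (closedChamber (labelDn p).1 (labelDn p).2 ∩ U).Nonempty)
    (hO : ∀ p ∈ PO, ∃ s : Fin 3 → Bool, (closedChamber (labelCorner p s).1 (labelCorner p s).2 ∩ U).Nonempty) :
    (coveredBonds X Pup Pdn PO).card ≤ brokenNear X U := by
  classical
  set BN : Set (Site × Site) := {q : Site × Site | q.1 ∈ X ∧ q.2 ∈ fccOffsets ∧ q.1 + q.2 ∉ X ∧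
    Metric.infDist ((Real.sqrt 2)⁻¹ • intVec (fccPoint q.1)) U ≤ Real.sqrt 2} with hBN
  have hfin : BN.Finite := by
    refine (Finset.finite_toSet (X ×ˢ fccOffsets)).subset ?_
    rintro q ⟨h1, h2, -, -⟩
    exact Finset.mem_coe.2 (Finset.mem_product.2 ⟨h1, h2⟩)
  have hsub : ((coveredBonds X Pup Pdn PO : Finset (Site × Site)) : Set (Site × Site)) ⊆ BN := by
    intro q hq
    rw [Finset.mem_coe, coveredBonds, Finset.mem_union, Finset.mem_union] at hq
    -- generic step: a slot pair of a cell whose occupied end is within `√2` of a point of `U`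
    have key : ∀ (p : Site) (v1 v2 : Site) (y : EuclideanSpace ℝ (Fin 3)), y ∈ U →
        p + v1 ∈ X → p + v2 ∉ X → v2 - v1 ∈ fccOffsets → dist (site (p + v1)) y ≤ Real.sqrt 2 →
        q = (p + v1, v2 - v1) → q ∈ BN := by
      rintro p v1 v2 y hyU h1 h2 hδ hd rfl
      refine ⟨h1, hδ, by rw [show p + v1 + (v2 - v1) = p + v2 by abel]; exact h2, ?_⟩
      exact le_trans (Metric.infDist_le_dist_of_mem hyU) (by rw [← site_eq]; exact hd)
    rcases hq with (hq | hq) | hq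
    · obtain ⟨p, hp, s, hs, h1, h2, rfl⟩ := (mem_covered tetUpV slotsTet).1 hq
      obtain ⟨y, hy, hyU⟩ := hup p hp
      exact key p _ _ y hyU h1 h2 (tetUp_himg s hs)
        (dist_le_sqrt2_of_mem_closedChamber (site_tetUpV_mem_closedChamber p s.1) hy) rfl
    · obtain ⟨p, hp, s, hs, h1, h2, rfl⟩ := (mem_covered tetDnV slotsTet).1 hq
      obtain ⟨y, hy, hyU⟩ := hdn p hp
      exact key p _ _ y hyU h1 h2 (tetDn_himg s hs)
        (dist_le_sqrt2_of_mem_closedChamber (site_tetDnV_mem_closedChamber p s.1) hy) rfl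
    · obtain ⟨p, hp, s, hs, h1, h2, rfl⟩ := (mem_covered octV slotsOct).1 hq
      obtain ⟨s₀, y, hy, hyU⟩ := hO p hp
      exact key p _ _ y hyU h1 h2 (oct_himg s hs) (dist_octV_le_sqrt2 p s₀ hy s.1) rfl
  rw [brokenNear, ← hBN, ← Set.ncard_coe_finset]
  exact Set.ncard_le_ncard hsub hfin

/-! ## Regrouping the per-cell costs -/

/-- **Regrouping**: the sum of the costs of the cells (anchored in `P`) whose closed chambers meet `U`
is at most the local tent cost of the families of such up-tetrahedra, down-tetrahedra and octahedra. -/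
theorem sum_cost_le_tentCostOn24 (X : Finset Site) (P : Finset Site)
    (meets : Site → (Bool ⊕ (Fin 3 → Bool)) → Prop) [∀ p κ, Decidable (meets p κ)] :
    (∑ r ∈ (P ×ˢ (univ : Finset (Bool ⊕ (Fin 3 → Bool)))).filter (fun r => meets r.1 r.2),
        (Sum.elim (fun bb => if bb then (2 * eTetUp X r.1 : ℝ) else (2 * eTetDn X r.1 : ℝ))
          (fun s => (corner (patO X r.1) (octIdx 0 (s 0)) (octIdx 1 (s 1)) (octIdx 2 (s 2)) : ℝ)) r.2)) ≤
      (tentCostOn24 X (P.filter fun p => meets p (Sum.inl true)) (P.filter fun p => meets p (Sum.inl false))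
        (P.filter fun p => ∃ s, meets p (Sum.inr s)) : ℝ) := by
  classical
  rw [Finset.sum_filter, Finset.sum_product]
  have hper : ∀ p ∈ P, (∑ κ : Bool ⊕ (Fin 3 → Bool), if meets p κ then
      Sum.elim (fun bb => if bb then (2 * eTetUp X p : ℝ) else (2 * eTetDn X p : ℝ))
        (fun s => (corner (patO X p) (octIdx 0 (s 0)) (octIdx 1 (s 1)) (octIdx 2 (s 2)) : ℝ)) κ else 0) ≤
      (if meets p (Sum.inl true) then (2 * eTetUp X p : ℝ) else 0) +
      (if meets p (Sum.inl false) then (2 * eTetDn X p : ℝ) else 0) +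
      (if ∃ s, meets p (Sum.inr s) then (octCost24 (patO X p) : ℝ) else 0) := by
    intro p _
    rw [Fintype.sum_sum_type, Fintype.sum_bool]
    simp only [Sum.elim_inl, Sum.elim_inr, if_true, Bool.false_eq_true, if_false]
    have hcor : (∑ s : Fin 3 → Bool, if meets p (Sum.inr s) then
        (corner (patO X p) (octIdx 0 (s 0)) (octIdx 1 (s 1)) (octIdx 2 (s 2)) : ℝ) else 0) ≤
        if ∃ s, meets p (Sum.inr s) then (octCost24 (patO X p) : ℝ) else 0 := by
      split_ifs with hex
      · have hsum := sum_corner_eq_octCost24 (patO X p)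
        have : (octCost24 (patO X p) : ℝ) =
            ∑ s : Fin 3 → Bool, (corner (patO X p) (octIdx 0 (s 0)) (octIdx 1 (s 1)) (octIdx 2 (s 2)) : ℝ) := by
          rw [← hsum]; push_cast; rfl
        rw [this]
        refine Finset.sum_le_sum fun s _ => ?_
        split_ifs
        · exact le_rfl
        · exact_mod_cast phiZ_nonneg _ _ _
      · push Not at hex
        rw [Finset.sum_eq_zero fun s _ => if_neg (hex s)]
    linarith [hcor]
  refine le_trans (Finset.sum_le_sum hper) ?_
  rw [Finset.sum_add_distrib, Finset.sum_add_distrib, ← Finset.sum_filter, ← Finset.sum_filter,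
    ← Finset.sum_filter, tentCostOn24]
  push_cast
  exact le_rfl

end Summit.Ventures.Crystal3D.TentCertificate

end
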